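import Literature.Analysis.Complex.BorelCaratheodoryDeriv
import Literature.NumberTheory.LFunctions.RodgersTaoAsymptotics
import Literature.NumberTheory.LFunctions.RodgersTaoAsymptoticsProofs
import Literature.NumberTheory.LFunctions.RodgersTaoTailSumProofs
import HarnessLib

/-!
# Rodgers–Tao 2020, towards Theorem 9 (49): propagation bricks for the logarithmic derivative (stage B)

Trunk T-ANT (`Literature/NumberTheory/LFunctions`). PROOFS ONLY: no definition, no named fact.
LINE 1 — LABEL: RH-FREE complex analysis in the service of Rodgers–Tao 2020 §3 (Theorem 9 (49));
bears_on LADDER-RH N-C/N-P (COLUMN 3, DBN). WHAT THIS IS NOT: general lemmas (Borel–Carathéodory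
off-centre, three-circles decay, the rescaling of Lemma 2.1 (9)); nothing here bears on RH.

## Context

The printed proof of Theorem 9 (49), p. 25, propagates the asymptotic (9)
`H_t′/H_t(z) = (i/4) Log(iz/4π) + O(log₊x/x)` — available only at depth `≥ C′ log₊ x` below the
real axis — up to depth `δ log₊ T` by a normal-families argument («F_n → F locally uniformly …
F′ = 1/4 … by unique continuation»). The effective replacement (seat rt-t6, architecture in the
cell HANDOFF) is: (B1) an a-priori bound for `F′/F` on discs below the axis from the one-sided
bound `log|H_t| ≤ −πx/8 + O(log²₊x)` ((7)) and the two-sided (8) at ONE deep base point, by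
Borel–Carathéodory; (B3) Hadamard's three-circles theorem between a deep circle (where (9) gives
`F′ − i/4 = O(1/log₊T)`), the target disc (depth `≥ δ`), and an outer circle (depth `≥ δ/2`, where
only the a-priori bound holds); (B4) the bookkeeping `(i/4)Log(iw/4π)/log₊T = i/4 + O(1/log₊T)`.
This file proves these three bricks in general form:

* `RodgersTaoLogDerivPropagation.borelCaratheodory_norm_le` — Mathlib's
  `Complex.borelCaratheodory_zero` at a general centre.
* `RodgersTaoLogDerivPropagation.norm_logDeriv_le_of_log_norm_le_offCentre` — `F` holomorphic,
  zero-free on `‖w − c‖ < R`, `log‖F w‖ ≤ log‖F c‖ + M` there; then for `‖z − c‖ ≤ r`, `r + ρ ≤ R`: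
  `‖F′(z)/F(z)‖ ≤ 2(M + 2Mr/(R − r))/ρ`.
* `RodgersTaoLogDerivPropagation.norm_le_of_three_circles_decay` — `‖G‖ ≤ η ≤ 1` on
  `‖z − c‖ ≤ r₁`, `‖G‖ ≤ M` (`M ≥ 1`) on `‖z − c‖ = r₃` ⟹ `‖G z‖ ≤ η^{1−a₂} M` on `‖z − c‖ ≤ r₂`,
  `a₂ = log(r₂/r₁)/log(r₃/r₁)` (from the tree's `InvZetaRH.norm_le_of_three_circles`).
* `RodgersTaoLogDerivPropagation.norm_div_logPlus_sub_le_of_eq9` — at `w = u − iv` with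
  `T/2 ≤ u ≤ 2T`, `0 ≤ v ≤ u`: `‖D − (i/4)Log(iw/4π)‖ ≤ E ⟹ ‖D/log₊T − i/4‖ ≤ (E + 2)/log₊T`.

* (B2) `RodgersTaoLogDerivPropagation.eq_rodgersTaoZ`, `logPlus_bounds`, `kappa_bounds`,
  `one_le_logPlus_le`, `log_norm_le_of_eq7_eq8`, `eq9_error_le` — the disc geometry in the
  coordinates `w = T + z·log₊ T` (every `w` is `rodgersTaoZ (Re w) κ′`, `κ′ = −Im w/log₊ Re w`;
  on the disc `‖w − (T − iRL)‖ ≤ (R − δ/16)L`, `4RL ≤ T`: `Re w ∈ [T/2, 2T]`, `κ′ ∈ [0, 4R]`, and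
  `κ′ ≥ C′` at depth `≥ 2C′L`), the Borel–Carathéodory constant `(πR/8 + 5A)L²` from (7)/(8), and
  the size `≤ 4A` of the (9) error on the disc.
* **(B-final) `RodgersTaoLogDerivPropagation.norm_logDeriv_rescaled_sub_le`** — at a fixed `t`
  with `H_t` real-rooted, from (7) (for `κ ∈ [0, C₇]`), (8), (9) (for `κ ∈ [C′, C₈]`, `x ≥ C″`) with
  `C₇, C₈ ≥ 4R`, `R = K²/δ + K + 2C′ + 2`: for `T ≥ 2`, `T ≥ 2C″`, `4R·log(2+T) ≤ T`,
  `4A + 2 ≤ log(2+T)`, `|s| ≤ K`, `y ∈ [δ, K]`: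
  `‖(H_t′/H_t)(T + (s − iy)L)/L − i/4‖ ≤ ((4A+2)/L)^{1−a₂} · (M₃ + 1)`, `L = log(2+T)`, with
  `a₂ = log(ρ₂/ρ₁)/log(ρ₃/ρ₁) < 1` (`ρ₁ = R − 2C′ − 2`, `ρ₂ = √(K² + (R−δ)²)`, `ρ₃ = R − δ/2`) and
  `M₃ = M₃(K, δ, C′, A)` explicit — i.e. `H_t′/H_t(T + (s − iy) log₊T) = (i/4 + O(L^{−θ})) log₊ T`
  uniformly for `|s| ≤ K`, `δ ≤ y ≤ K`, `θ = 1 − a₂ > 0`: the printed «F_n′ → 1/4 locally uniformly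
  on the lower half-plane» with a rate.
* **`RodgersTaoLogDerivPropagation.exists_norm_logDeriv_rescaled_sub_le (T₀)`** — STAGE B OVER
  THE KERNEL THEOREMS: for `0 < δ ≤ 1 ≤ K` there are `T₁`, `Cst ≥ 0`, `θ > 0` with
  `‖(H_t′/H_t)(T + (s − iy)L)/L − i/4‖ ≤ Cst·L^{−θ}` for all `t ∈ [−T₀, 0]` with `H_t` real-rooted,
  `T ≥ T₁`, `|s| ≤ K`, `y ∈ [δ, K]` — from `rodgersTao_H_bound_holds` (7), `rodgersTao_H_asymp_holds`
  (8), `rodgersTao_logDeriv_H_asymp_holds` (9) (constants uniform in `t` on the window; common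
  `C′ = max`, `A = max`, `C″ = max`; `T₁ = max(2, 2C″, e^{4A+2}, (8R+2)²)`).
* `RodgersTaoLogDerivPropagation.im_bounds_of_norm_div_sub_le`, `exists_im_logDeriv_bounds (T₀)` —
  the same in the form consumed by the Poisson counting of stage C:
  `(1/4 − Cst L^{−θ})L ≤ Im (H_t′/H_t)(T + sL − iyL) ≤ (1/4 + Cst L^{−θ})L`.

## References

* B. Rodgers, T. Tao, *The de Bruijn–Newman constant is non-negative*, Forum Math. Pi 8 (2020),
  e6 = arXiv:1801.05914: Lemma 4 (7)–(9) p. 8; Theorem 9 (49) and its proof pp. 23–25.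
  [RodgersTaoFMP2020]
* H. L. Montgomery, R. C. Vaughan, *Multiplicative Number Theory I*, CUP 2007, Ch. 6, Lemma 6.2
  (Borel–Carathéodory). [MontgomeryVaughan2007]
-/

noncomputable section

open Complex Set Filter Topology Metric
open scoped Real

namespace Literature.NumberTheory.LFunctions

namespace RodgersTaoLogDerivPropagation

/-! ## Brick B1: a-priori bound for a logarithmic derivative off the centre of a Borel–Carathéodory disc -/

/-- **Borel–Carathéodory, modulus form at a general centre**: `f` holomorphic on `‖w − c‖ < R`,
`f c = 0`, `Re f ≤ M` (`M > 0`) there `⇒ ‖f z‖ ≤ 2M‖z − c‖/(R − ‖z − c‖)` for `‖z − c‖ < R`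
(Mathlib's `Complex.borelCaratheodory_zero`, translated). [cite: MontgomeryVaughan2007, Ch. 6, Lemma 6.2] -/
theorem borelCaratheodory_norm_le {f : ℂ → ℂ} {c z : ℂ} {M R : ℝ} (hM : 0 < M) (hR : 0 < R)
    (hf : DifferentiableOn ℂ f (ball c R)) (hre : ∀ w ∈ ball c R, (f w).re ≤ M) (hfc : f c = 0)
    (hz : z ∈ ball c R) : ‖f z‖ ≤ 2 * M * ‖z - c‖ / (R - ‖z - c‖) := by
  set g : ℂ → ℂ := fun w ↦ f (c + w) with hg
  have hmaps : MapsTo (fun w : ℂ ↦ c + w) (ball 0 R) (ball c R) := by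
    intro w hw
    simpa [mem_ball, dist_eq_norm] using hw
  have hgd : DifferentiableOn ℂ g (ball 0 R) :=
    hf.comp ((differentiableOn_const c).add differentiableOn_id) hmaps
  have hgre : MapsTo g (ball 0 R) {z | z.re ≤ M} := fun w hw ↦ hre _ (hmaps hw)
  have hg0 : g 0 = 0 := by simp [hg, hfc]
  have hz' : z - c ∈ ball (0 : ℂ) R := by
    simpa [mem_ball, dist_eq_norm] using hz
  have h := Complex.borelCaratheodory_zero hM hgd hgre hR hz' hg0
  have e : g (z - c) = f z := by simp [hg]
  rwa [e] at h

/-- **A-priori bound for `F′/F` away from the centre.** Let `F` be holomorphic and zero-free on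
`‖w − c‖ < R` with `log ‖F w‖ ≤ log ‖F c‖ + M` there (`M > 0`). Then for `‖z − c‖ ≤ r` and
`ρ > 0` with `r + ρ ≤ R`: `‖F′(z)/F(z)‖ ≤ 2 (M + 2Mr/(R − r))/ρ`. Proof: Borel–Carathéodory for
`h = log(F/F(c))` gives `log ‖F z‖ ≥ log ‖F c‖ − 2Mr/(R − r)`, so on the disc `‖w − z‖ < ρ` the
hypothesis of the centred form `norm_logDeriv_le_of_log_norm_le` holds with `M + 2Mr/(R − r)`.
(This is the step «the F_n are uniformly bounded on compact subsets … hence so are the F_n′» of the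
normal-families proof of Theorem 9 (49), p. 25, made quantitative.)
[cite: RodgersTaoFMP2020, Theorem 9 (49) proof p.25; MontgomeryVaughan2007, Ch. 6, Lemma 6.2] -/
theorem norm_logDeriv_le_of_log_norm_le_offCentre {F : ℂ → ℂ} {c z : ℂ} {M R r ρ : ℝ}
    (hM : 0 < M) (hρ : 0 < ρ) (hr : ‖z - c‖ ≤ r) (hrρ : r + ρ ≤ R)
    (hF : DifferentiableOn ℂ F (ball c R)) (hF0 : ∀ w ∈ ball c R, F w ≠ 0)
    (hlog : ∀ w ∈ ball c R, Real.log ‖F w‖ ≤ Real.log ‖F c‖ + M) :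
    ‖deriv F z / F z‖ ≤ 2 * (M + 2 * M * r / (R - r)) / ρ := by
  have hr0 : 0 ≤ r := (norm_nonneg _).trans hr
  have hrR : r < R := by linarith
  have hR : 0 < R := by linarith
  have hzc : z ∈ ball c R := by
    rw [mem_ball, dist_eq_norm]; linarith
  -- a holomorphic logarithm of `F` on the disc and Borel–Carathéodory for `h = L − L c`
  obtain ⟨L, hLd, -, hLder, hexp⟩ := InvZetaRH.exists_log_of_ball hR hF hF0
  have hre_eq : ∀ w ∈ ball c R, (L w).re = Real.log ‖F w‖ := by
    intro w hw
    have h1 : ‖F w‖ = Real.exp (L w).re := by rw [← hexp w hw, Complex.norm_exp]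
    rw [h1, Real.log_exp]
  set h : ℂ → ℂ := fun w ↦ L w - L c with hh
  have hhd : DifferentiableOn ℂ h (ball c R) := hLd.sub_const _
  have hhc : h c = 0 := by simp [hh]
  have hhre : ∀ w ∈ ball c R, (h w).re ≤ M := by
    intro w hw
    have h1 := hre_eq w hw
    have h2 := hre_eq c (mem_ball_self hR)
    simp only [hh, sub_re, h1, h2]
    linarith [hlog w hw]
  have hBC := borelCaratheodory_norm_le hM hR hhd hhre hhc hzc
  -- `‖h z‖ ≤ 2Mr/(R − r)`
  have hzb : 2 * M * ‖z - c‖ / (R - ‖z - c‖) ≤ 2 * M * r / (R - r) := by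
    have h1 : 0 < R - ‖z - c‖ := by linarith
    have h2 : 0 < R - r := by linarith
    rw [div_le_div_iff₀ h1 h2]
    have := mul_le_mul_of_nonneg_left hr (by positivity : (0 : ℝ) ≤ 2 * M * R)
    nlinarith [norm_nonneg (z - c)]
  have hlow : Real.log ‖F c‖ - 2 * M * r / (R - r) ≤ Real.log ‖F z‖ := by
    have h1 : |(h z).re| ≤ ‖h z‖ := Complex.abs_re_le_norm _
    have h2 : (h z).re = Real.log ‖F z‖ - Real.log ‖F c‖ := by
      simp only [hh, sub_re, hre_eq z hzc, hre_eq c (mem_ball_self hR)]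
    have h3 := neg_abs_le (h z).re
    linarith
  -- the centred form on the disc `‖w − z‖ < ρ`
  have hsub : ball z ρ ⊆ ball c R := by
    intro w hw
    rw [mem_ball, dist_eq_norm] at hw ⊢
    calc ‖w - c‖ = ‖(w - z) + (z - c)‖ := by ring_nf
      _ ≤ ‖w - z‖ + ‖z - c‖ := norm_add_le _ _
      _ < ρ + r := by linarith
      _ ≤ R := by linarith
  have hM' : 0 < M + 2 * M * r / (R - r) := by
    have : 0 ≤ 2 * M * r / (R - r) := div_nonneg (by positivity) (by linarith)
    linarith
  refine Literature.Analysis.Complex.norm_logDeriv_le_of_log_norm_le hM' hρ (hF.mono hsub)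
    (fun w hw ↦ hF0 w (hsub hw)) fun w hw ↦ ?_
  have := hlog w (hsub hw)
  linarith

/-! ## Brick B3: three-circles decay packaged for «small on the inner disc, bounded on the outer circle» -/

/-- **Three-circles decay.** `G` holomorphic on `‖z − c‖ < R'`; `‖G‖ ≤ η ≤ 1` on the closed inner
disc `‖z − c‖ ≤ r₁` and `‖G‖ ≤ M` (`M ≥ 1`) on the outer circle `‖z − c‖ = r₃`
(`0 < r₁ ≤ r₂ < r₃ < R'`). Then `‖G z‖ ≤ η^{1 − a₂} · M` on `‖z − c‖ ≤ r₂`, with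
`a₂ = log(r₂/r₁)/log(r₃/r₁) < 1` (Hadamard's three-circles theorem,
`InvZetaRH.norm_le_of_three_circles`, with the exponents made uniform on the middle disc). This
is the quantitative replacement for the Montel/identity-theorem step of the proof of Theorem 9
(49), p. 25 («F′ = 1/4 whenever Im z is sufficiently large and negative; by unique continuation
… for all z in the lower half-plane»): smallness deep down propagates to the middle disc with a
loss of a fixed power. [cite: RodgersTaoFMP2020, Theorem 9 (49) proof p.25] -/
theorem norm_le_of_three_circles_decay {G : ℂ → ℂ} {c : ℂ} {R' r₁ r₂ r₃ η M : ℝ}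
    (hr₁ : 0 < r₁) (h12 : r₁ ≤ r₂) (h23 : r₂ < r₃) (h3R : r₃ < R')
    (hG : DifferentiableOn ℂ G (ball c R')) (hη : 0 < η) (hη1 : η ≤ 1) (hM : 1 ≤ M)
    (h1 : ∀ z : ℂ, ‖z - c‖ ≤ r₁ → ‖G z‖ ≤ η) (h3 : ∀ z : ℂ, ‖z - c‖ = r₃ → ‖G z‖ ≤ M)
    {z : ℂ} (hz : ‖z - c‖ ≤ r₂) :
    ‖G z‖ ≤ η ^ (1 - Real.log (r₂ / r₁) / Real.log (r₃ / r₁)) * M := by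
  have hr₃ : 0 < r₃ := by linarith
  have h13 : r₁ < r₃ := by linarith
  have hlog31 : 0 < Real.log (r₃ / r₁) := Real.log_pos (by rw [one_lt_div hr₁]; exact h13)
  set a₂ : ℝ := Real.log (r₂ / r₁) / Real.log (r₃ / r₁) with ha₂
  have ha₂0 : 0 ≤ a₂ := div_nonneg (Real.log_nonneg (by rw [le_div_iff₀ hr₁]; linarith)) hlog31.le
  have ha₂1 : a₂ ≤ 1 := by
    rw [ha₂, div_le_one hlog31]
    exact Real.log_le_log (div_pos (by linarith) hr₁)
      (by rw [div_le_div_iff_of_pos_right hr₁]; exact h23.le)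
  rcases le_or_gt ‖z - c‖ r₁ with hin | hout
  · -- deep point: `‖G z‖ ≤ η ≤ η^{1−a₂} ≤ η^{1−a₂} M`
    have h1z := h1 z hin
    have hpow : η ≤ η ^ (1 - a₂) := by
      have := Real.rpow_le_rpow_of_exponent_ge hη hη1 (by linarith : 1 - a₂ ≤ 1)
      rwa [Real.rpow_one] at this
    have hpos : 0 ≤ η ^ (1 - a₂) := Real.rpow_nonneg hη.le _
    calc ‖G z‖ ≤ η := h1z
      _ ≤ η ^ (1 - a₂) := hpow
      _ = η ^ (1 - a₂) * 1 := (mul_one _).symm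
      _ ≤ η ^ (1 - a₂) * M := mul_le_mul_of_nonneg_left hM hpos
  · -- three circles between `r₁` and `r₃`
    have hM₁ : ∀ w : ℂ, ‖w - c‖ = r₁ → ‖G w‖ ≤ η := fun w hw ↦ h1 w hw.le
    have key := InvZetaRH.norm_le_of_three_circles hr₁ h13 h3R hG hM₁ h3 hout.le (hz.trans h23.le)
    set a : ℝ := Real.log (‖z - c‖ / r₁) / Real.log (r₃ / r₁) with ha
    have ha0 : 0 ≤ a :=
      div_nonneg (Real.log_nonneg (by rw [le_div_iff₀ hr₁]; linarith)) hlog31.le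
    have haa₂ : a ≤ a₂ := by
      rw [ha, ha₂]
      refine div_le_div_of_nonneg_right (Real.log_le_log (div_pos (by linarith) hr₁) ?_) hlog31.le
      exact div_le_div_of_nonneg_right hz hr₁.le
    have hpow1 : η ^ (1 - a) ≤ η ^ (1 - a₂) :=
      Real.rpow_le_rpow_of_exponent_ge hη hη1 (by linarith)
    have hpow2 : M ^ a ≤ M := by
      have := Real.rpow_le_rpow_of_exponent_le hM (haa₂.trans ha₂1)
      rwa [Real.rpow_one] at this
    calc ‖G z‖ ≤ η ^ (1 - a) * M ^ a := key
      _ ≤ η ^ (1 - a₂) * M := mul_le_mul hpow1 hpow2 (Real.rpow_nonneg (by linarith) _)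
          (Real.rpow_nonneg hη.le _)

/-! ## Brick B4: from Lemma 2.1 (9) at a deep point to the rescaled statement `H′/H(w)/log₊T ≈ i/4` -/

/-- The main term of (9) at the scale `log₊ T`: for `T ≥ 2`, `T/2 ≤ u ≤ 2T`, `0 ≤ v ≤ u`, the
point `q = i(u − iv)/(4π) = (v + iu)/(4π)` has `|Log q − log(2+T)| ≤ 6` (modulus within a bounded
factor of `T`, argument in `[0, π/2]`). [folklore] -/
private theorem norm_log_sub_logPlus_le {u v T : ℝ} (hT : 2 ≤ T) (hu : T / 2 ≤ u) (hu' : u ≤ 2 * T)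
    (hv0 : 0 ≤ v) (hv : v ≤ u) :
    ‖Complex.log (I * ((u : ℂ) - (v : ℂ) * I) / (4 * π)) - Real.log (2 + T)‖ ≤ 6 := by
  have hπ : 0 < π := Real.pi_pos
  have hu0 : 0 < u := by linarith
  set q : ℂ := I * ((u : ℂ) - (v : ℂ) * I) / (4 * π) with hq
  have h4π : (4 * (π : ℂ)) = ((4 * π : ℝ) : ℂ) := by push_cast; ring
  have hz_re : (I * ((u : ℂ) - (v : ℂ) * I)).re = v := by simp
  have hz_im : (I * ((u : ℂ) - (v : ℂ) * I)).im = u := by simp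
  have hqre : q.re = v / (4 * π) := by rw [hq, h4π, Complex.div_ofReal_re, hz_re]
  have hqim : q.im = u / (4 * π) := by rw [hq, h4π, Complex.div_ofReal_im, hz_im]
  have hqre0 : 0 ≤ q.re := by rw [hqre]; positivity
  have hqim0 : 0 < q.im := by rw [hqim]; positivity
  have hq0 : q ≠ 0 := fun h ↦ by rw [h] at hqim0; simp at hqim0
  -- modulus: `u/(4π) ≤ ‖q‖ ≤ (u+v)/(4π)`
  have hnorm_lo : u / (4 * π) ≤ ‖q‖ := by
    calc u / (4 * π) = |q.im| := by rw [hqim, abs_of_pos (by positivity)]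
      _ ≤ ‖q‖ := Complex.abs_im_le_norm q
  have hnorm_hi : ‖q‖ ≤ (u + v) / (4 * π) := by
    calc ‖q‖ ≤ |q.re| + |q.im| := Complex.norm_le_abs_re_add_abs_im q
      _ = (u + v) / (4 * π) := by
        rw [hqre, hqim, abs_of_nonneg (by positivity), abs_of_pos (by positivity)]; ring
  have hnorm0 : 0 < ‖q‖ := norm_pos_iff.2 hq0
  -- real part of the logarithm
  have hre : |(Complex.log q).re - Real.log (2 + T)| ≤ 4 := by
    rw [Complex.log_re]
    have h16π : Real.log (16 * π) < 4 := by
      have : 16 * π < Real.exp 4 := by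
        have h1 := Real.pi_lt_d2
        have h2 : (2.7 : ℝ) < Real.exp 1 := lt_trans (by norm_num) Real.exp_one_gt_d9
        have h3 : Real.exp 4 = Real.exp 1 ^ 4 := by rw [← Real.exp_nat_mul]; norm_num
        nlinarith [h3, pow_le_pow_left₀ (by norm_num : (0:ℝ) ≤ 2.7) h2.le 4]
      calc Real.log (16 * π) < Real.log (Real.exp 4) := Real.log_lt_log (by positivity) this
        _ = 4 := Real.log_exp 4
    -- lower: `‖q‖ ≥ u/(4π) ≥ T/(8π) ≥ (2+T)/(16π)`
    have hlo : Real.log (2 + T) - 4 ≤ Real.log ‖q‖ := by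
      have h1 : (2 + T) / (16 * π) ≤ ‖q‖ := by
        refine le_trans ?_ hnorm_lo
        rw [div_le_div_iff₀ (by positivity) (by positivity)]
        nlinarith
      have h2 : Real.log ((2 + T) / (16 * π)) = Real.log (2 + T) - Real.log (16 * π) := by
        rw [Real.log_div (by positivity) (by positivity)]
      have h3 := Real.log_le_log (by positivity) h1
      linarith
    -- upper: `‖q‖ ≤ (u+v)/(4π) ≤ 4T/(4π) ≤ 2 + T`
    have hhi : Real.log ‖q‖ ≤ Real.log (2 + T) := by
      refine Real.log_le_log hnorm0 (hnorm_hi.trans ?_)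
      rw [div_le_iff₀ (by positivity)]
      nlinarith [Real.pi_gt_three]
    rw [abs_le]; constructor <;> linarith
  -- imaginary part: the argument lies in `[0, π/2]`
  have him : |(Complex.log q).im| ≤ 2 := by
    rw [Complex.log_im]
    have h1 : 0 ≤ Complex.arg q := Complex.arg_nonneg_iff.2 hqim0.le
    have h2 : Complex.arg q ≤ π / 2 := Complex.arg_le_pi_div_two_iff.2 (Or.inl hqre0)
    rw [abs_of_nonneg h1]
    linarith [Real.pi_lt_four]
  calc ‖Complex.log q - Real.log (2 + T)‖
      ≤ |(Complex.log q - Real.log (2 + T)).re| + |(Complex.log q - Real.log (2 + T)).im| :=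
        Complex.norm_le_abs_re_add_abs_im _
    _ ≤ 4 + 2 := by
        refine add_le_add ?_ ?_
        · simpa [Complex.sub_re, Complex.ofReal_re] using hre
        · simpa [Complex.sub_im, Complex.ofReal_im] using him
    _ = 6 := by norm_num

/-- **From (9) at a deep point to the rescaled logarithmic derivative.** If at `w = u − iv` with
`T/2 ≤ u ≤ 2T`, `0 ≤ v ≤ u` (`T ≥ 2`) the logarithmic derivative satisfies Lemma 2.1 (9) with
error `E`, `‖D − (i/4) Log(iw/4π)‖ ≤ E` (`D = H_t′/H_t(w)`), then
`‖D/log₊T − i/4‖ ≤ (E + 2)/log₊T` (`log₊ T = log(2+T)`): the rescaled logarithmic derivative is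
`i/4 + O(1/log₊T)` at every point of the region where (9) is available — the input
«F_n′ → 1/4 where (9) applies» of the proof of Theorem 9 (49), p. 25, in quantitative form.
[cite: RodgersTaoFMP2020, Lemma 4 (9) p.8 and Theorem 9 (49) proof p.25] -/
theorem norm_div_logPlus_sub_le_of_eq9 {D : ℂ} {u v T E : ℝ} (hT : 2 ≤ T) (hu : T / 2 ≤ u)
    (hu' : u ≤ 2 * T) (hv0 : 0 ≤ v) (hv : v ≤ u)
    (h9 : ‖D - I / 4 * Complex.log (I * ((u : ℂ) - (v : ℂ) * I) / (4 * π))‖ ≤ E) :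
    ‖D / (Real.log (2 + T) : ℂ) - I / 4‖ ≤ (E + 2) / Real.log (2 + T) := by
  set L : ℝ := Real.log (2 + T) with hL
  have hL0 : 0 < L := Real.log_pos (by linarith)
  have hLc : (L : ℂ) ≠ 0 := by exact_mod_cast hL0.ne'
  set Q : ℂ := Complex.log (I * ((u : ℂ) - (v : ℂ) * I) / (4 * π)) with hQ
  have hmain := norm_log_sub_logPlus_le hT hu hu' hv0 hv
  have e : D / (L : ℂ) - I / 4 = ((D - I / 4 * Q) + I / 4 * (Q - (L : ℂ))) / (L : ℂ) := by
    field_simp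
    ring
  rw [e, norm_div, Complex.norm_real, Real.norm_of_nonneg hL0.le, div_le_div_iff_of_pos_right hL0]
  calc ‖D - I / 4 * Q + I / 4 * (Q - (L : ℂ))‖
      ≤ ‖D - I / 4 * Q‖ + ‖I / 4 * (Q - (L : ℂ))‖ := norm_add_le _ _
    _ ≤ E + 1 / 4 * 6 := by
        refine add_le_add h9 ?_
        rw [norm_mul, norm_div, Complex.norm_I]
        have : ‖(4 : ℂ)‖ = 4 := by simp
        rw [this]
        exact mul_le_mul_of_nonneg_left hmain (by norm_num)
    _ ≤ E + 2 := by norm_num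


/-! ## Brick B2: the disc geometry in the coordinates `w = T + z·log₊ T` -/

/-- Every point of the closed lower half-plane is a point `rodgersTaoZ x κ` of Lemma 2.1:
`w = x − iκ log₊ x` with `x = Re w`, `κ = −Im w/log₊(Re w)` (the parametrisation of Lemma 4).
[cite: RodgersTaoFMP2020, Lemma 4 p.8 (the points z = x − iκ log₊ x)] -/
theorem eq_rodgersTaoZ (w : ℂ) : w = rodgersTaoZ w.re (-w.im / logPlus w.re) := by
  have hL : logPlus w.re ≠ 0 := (logPlus_pos _).ne'
  apply Complex.ext
  · simp [rodgersTaoZ]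
  · simp [rodgersTaoZ]
    field_simp

/-- `log₊(T/2) ≥ log₊(T)/2` and `log₊(2T) ≤ 2 log₊ T` type bounds: for `T ≥ 2` and
`T/2 ≤ u ≤ 2T`, `log(2+T)/2 ≤ log₊ u ≤ 2 log(2+T)` (`log₊` of §1.2).
[cite: RodgersTaoFMP2020, §1.2 p.7 (notation log₊) and Lemma 4 p.8] -/
theorem logPlus_bounds {u T : ℝ} (hT : 2 ≤ T) (hu : T / 2 ≤ u) (hu' : u ≤ 2 * T) :
    Real.log (2 + T) / 2 ≤ logPlus u ∧ logPlus u ≤ 2 * Real.log (2 + T) := by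
  have hu0 : 0 < u := by linarith
  rw [logPlus_eq, abs_of_pos hu0]
  have hL0 : 0 < Real.log (2 + T) := Real.log_pos (by linarith)
  constructor
  · -- `(2 + T) ≤ (2 + u)²`
    have h1 : Real.log (2 + T) ≤ Real.log ((2 + u) ^ 2) :=
      Real.log_le_log (by linarith) (by nlinarith)
    rw [Real.log_pow] at h1
    push_cast at h1
    linarith
  · -- `2 + u ≤ (2 + T)²`
    have h1 : Real.log (2 + u) ≤ Real.log ((2 + T) ^ 2) :=
      Real.log_le_log (by linarith) (by nlinarith)
    rw [Real.log_pow] at h1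
    push_cast at h1
    linarith

/-- **The disc geometry.** Let `T ≥ 2`, `L = log(2+T)`, `R > 0` with `4RL ≤ T`, and let `w` satisfy
`|Re w − T| ≤ RL` and `0 ≤ −Im w ≤ 2RL` (every point of the closed disc `‖w − (T − iRL)‖ ≤ RL` does).
Then `u = Re w ∈ [T/2, 2T]`, `v = −Im w ∈ [0, u]`, and the Lemma-2.1 parameter
`κ′ = v/log₊ u` lies in `[0, 4R]`; if moreover `v ≥ 2C′L` then `κ′ ≥ C′` — i.e. the disc lies in
the region `0 ≤ κ ≤ C` of Lemma 4 (7) and its deep part in the region `C′ ≤ κ ≤ C` of (8)/(9).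
[cite: RodgersTaoFMP2020, Lemma 4 p.8 (the regions 0 ≤ κ ≤ C and C′ ≤ κ ≤ C)] -/
theorem kappa_bounds {w : ℂ} {T R C' : ℝ} (hT : 2 ≤ T) (hR : 0 < R)
    (hRT : 4 * R * Real.log (2 + T) ≤ T) (hre : |w.re - T| ≤ R * Real.log (2 + T))
    (him0 : 0 ≤ -w.im) (him : -w.im ≤ 2 * R * Real.log (2 + T)) :
    T / 2 ≤ w.re ∧ w.re ≤ 2 * T ∧ -w.im ≤ w.re ∧
      0 ≤ -w.im / logPlus w.re ∧ -w.im / logPlus w.re ≤ 4 * R ∧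
      (0 ≤ C' → 2 * C' * Real.log (2 + T) ≤ -w.im → C' ≤ -w.im / logPlus w.re) := by
  set L : ℝ := Real.log (2 + T) with hL
  have hL0 : 0 < L := Real.log_pos (by linarith)
  obtain ⟨h1, h2⟩ := abs_le.1 hre
  have hu1 : T / 2 ≤ w.re := by nlinarith
  have hu2 : w.re ≤ 2 * T := by nlinarith
  obtain ⟨hlo, hhi⟩ := logPlus_bounds hT hu1 hu2
  have hLu : 0 < logPlus w.re := logPlus_pos _
  refine ⟨hu1, hu2, by nlinarith, div_nonneg him0 hLu.le, ?_, fun hC' hdeep ↦ ?_⟩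
  · rw [div_le_iff₀ hLu]
    nlinarith
  · rw [le_div_iff₀ hLu]
    nlinarith

/-- `1 ≤ log(2+T) ≤ T` for `T ≥ 2`. [folklore] -/
private theorem one_le_logPlus_le {T : ℝ} (hT : 2 ≤ T) : 1 ≤ Real.log (2 + T) ∧ Real.log (2 + T) ≤ T := by
  constructor
  · have h4 : Real.log 4 ≤ Real.log (2 + T) := Real.log_le_log (by norm_num) (by linarith)
    have : (1 : ℝ) < Real.log 4 := by
      rw [Real.lt_log_iff_exp_lt (by norm_num)]
      have := Real.exp_one_lt_d9; linarith
    linarith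
  · have h1 : Real.log (2 + T) < (2 + T) / 2 + 0 := by
      have := Real.log_le_sub_one_of_pos (by linarith : (0:ℝ) < (2 + T) / 2)
      have h2 : Real.log (2 + T) = Real.log ((2 + T) / 2) + Real.log 2 := by
        rw [Real.log_div (by linarith) (by norm_num)]; ring
      have h3 := Real.log_two_lt_d9
      linarith
    linarith

/-- **The Borel–Carathéodory constant (step (ii)).** From (7) at the point `w` (`u = Re w`,
`|u − T| ≤ RL`, `T/2 ≤ u ≤ 2T`) and (8) at the base point `c` (`x = T`):
`log ‖H w‖ ≤ log ‖H c‖ + (πR/8 + 5A) L²`, `L = log(2+T)`. [folklore] -/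
private theorem log_norm_le_of_eq7_eq8 {a b : ℂ} {u T R A : ℝ} (hT : 2 ≤ T) (hA : 0 ≤ A)
    (ha0 : a ≠ 0) (hu : T / 2 ≤ u) (hu' : u ≤ 2 * T) (huT : |u - T| ≤ R * Real.log (2 + T))
    (h7 : ‖a‖ ≤ Real.exp (-(π * u / 8) + A * logPlus u ^ 2))
    (h8 : Real.exp (-(π * T / 8) - A * Real.log (2 + T) ^ 2) ≤ ‖b‖) :
    Real.log ‖a‖ ≤ Real.log ‖b‖ + (π * R / 8 + 5 * A) * Real.log (2 + T) ^ 2 := by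
  set L : ℝ := Real.log (2 + T) with hL
  obtain ⟨hL1, -⟩ := one_le_logPlus_le hT
  obtain ⟨-, hhi⟩ := logPlus_bounds hT hu hu'
  have hπ : 0 < π := Real.pi_pos
  have h1 : Real.log ‖a‖ ≤ -(π * u / 8) + A * logPlus u ^ 2 := by
    have := Real.log_le_log (norm_pos_iff.2 ha0) h7
    rwa [Real.log_exp] at this
  have h2 : -(π * T / 8) - A * L ^ 2 ≤ Real.log ‖b‖ := by
    have := Real.log_le_log (Real.exp_pos _) h8
    rwa [Real.log_exp] at this
  have h3 : logPlus u ^ 2 ≤ 4 * L ^ 2 := by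
    have h0 : 0 ≤ logPlus u := logPlus_nonneg _
    nlinarith
  have h4 : -(π * u / 8) ≤ -(π * T / 8) + π * R * L / 8 := by
    obtain ⟨h5, -⟩ := abs_le.1 huT
    nlinarith
  have h5 : π * R * L / 8 ≤ π * R / 8 * L ^ 2 := by
    have hR : 0 ≤ R * L := le_trans (abs_nonneg _) huT
    have : R * L ≤ R * L * L := by nlinarith
    nlinarith
  nlinarith

/-- **The (9) error at the scale of the disc (step (iv)).** For `T/2 ≤ u ≤ 2T`, `T ≥ 2`, `A ≥ 0`:
`A log₊u/u ≤ 4A`. [folklore] -/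
private theorem eq9_error_le {u T A : ℝ} (hT : 2 ≤ T) (hA : 0 ≤ A) (hu : T / 2 ≤ u) (hu' : u ≤ 2 * T) :
    A * logPlus u / u ≤ 4 * A := by
  obtain ⟨-, hLT⟩ := one_le_logPlus_le hT
  obtain ⟨-, hhi⟩ := logPlus_bounds hT hu hu'
  have hu0 : 0 < u := by linarith
  rw [div_le_iff₀ hu0]
  nlinarith

/-! ## B-final: propagation of (9) from depth `κ log₊ T` to depth `δ log₊ T` -/

/-- `rodgersTaoZ u κ′` in the form `u − v·i` with `v = κ′ log₊ u`.
[cite: RodgersTaoFMP2020, Lemma 4 p.8 (the points z = x − iκ log₊ x)] -/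
theorem rodgersTaoZ_eq_sub_mul_I (u κ : ℝ) :
    rodgersTaoZ u κ = (u : ℂ) - ((κ * logPlus u : ℝ) : ℂ) * I := by
  simp only [rodgersTaoZ]; ring

/-- The base point `T − iRL` is `rodgersTaoZ T R` (`L = log₊ T = log(2+T)` for `T ≥ 0`).
[cite: RodgersTaoFMP2020, Lemma 4 p.8 (the points z = x − iκ log₊ x)] -/
theorem base_eq_rodgersTaoZ {T R : ℝ} (hT : 0 ≤ T) :
    (T : ℂ) - ((R * Real.log (2 + T) : ℝ) : ℂ) * I = rodgersTaoZ T R := by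
  rw [rodgersTaoZ_eq_sub_mul_I, logPlus_eq, abs_of_nonneg hT]

/-- Real/imaginary parts within a disc: `|Re w − Re c| ≤ ‖w − c‖`, `|Im w − Im c| ≤ ‖w − c‖`. [folklore] -/
private theorem abs_re_im_sub_le (w c : ℂ) :
    |w.re - c.re| ≤ ‖w - c‖ ∧ |w.im - c.im| ≤ ‖w - c‖ :=
  ⟨by simpa using Complex.abs_re_le_norm (w - c), by simpa using Complex.abs_im_le_norm (w - c)⟩


set_option maxHeartbeats 400000 in
/-- **Propagation of Lemma 2.1 (9) towards the real axis (stage B of the effective proof of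
Theorem 9 (49)).** Fix `t` with `H_t` real-rooted and suppose the conclusions of Lemma 2.1 hold at
time `t` in the typed shapes of `rodgersTao_H_bound` (7) (for `0 ≤ κ ≤ C₇`), `rodgersTao_H_asymp`
(8) and `rodgersTao_logDeriv_H_asymp` (9) (for `C′ ≤ κ ≤ C₈`, `x ≥ C″`). Let `0 < δ ≤ 1 ≤ K`,
`R = K²/δ + K + 2C′ + 2`, `C₇, C₈ ≥ 4R`. Then for `T ≥ 2` with `T ≥ 2C″`, `4R log(2+T) ≤ T`,
`4A + 2 ≤ log(2+T)`, and all `|s| ≤ K`, `δ ≤ y ≤ K`: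
`‖(H_t′/H_t)(T + (s − iy)L)/L − i/4‖ ≤ η^{1−a₂}·(M₃ + 1)`, `L = log(2+T)`, `η = (4A+2)/L`, with
`a₂ = log(ρ₂/ρ₁)/log(ρ₃/ρ₁) < 1` and `M₃` depending on `K, δ, C′, A` only (explicit below).
Proof (quantitative replacement of the normal-families step of the printed proof, p. 25): on the
disc `‖w − (T − iRL)‖ < (R − δ/16)L` the function `H_t` is zero-free and
`log|H_t w| ≤ log|H_t(T − iRL)| + (πR/8 + 5A)L²` ((7) at `w`, (8) at the base); Borel–Carathéodory
off-centre gives `|H_t′/H_t| ≤ M₃ L` on `‖w − (T − iRL)‖ ≤ (R − δ/2)L`; (9) gives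
`|H_t′/H_t/L − i/4| ≤ η` on the deep disc `‖w − (T − iRL)‖ ≤ (R − 2C′ − 2)L`; Hadamard's three
circles interpolate at `T + (s − iy)L`, which lies within radius `ρ₂L`, `ρ₂ = √(K² + (R−δ)²) < R − δ/2`.
[cite: RodgersTaoFMP2020, Lemma 4 (7)(8)(9) p.8 and Theorem 9 (49) proof p.25] -/
theorem norm_logDeriv_rescaled_sub_le {t : ℝ} (hreal : HasOnlyRealZeros (deBruijnH t))
    {C' C'' C₇ C₈ A δ K : ℝ} (hC' : 0 ≤ C') (hA : 0 ≤ A) (hδ : 0 < δ) (hδ1 : δ ≤ 1) (hK : 1 ≤ K)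
    (h7 : ∀ x : ℝ, 0 ≤ x → ∀ κ ∈ Icc 0 C₇,
      ‖deBruijnH t (rodgersTaoZ x κ)‖ ≤ Real.exp (-(π * x / 8) + A * logPlus x ^ 2))
    (h8 : ∀ x : ℝ, C'' ≤ x → ∀ κ ∈ Icc C' C₈,
      Real.exp (-(π * x / 8) - A * logPlus x ^ 2) ≤ ‖deBruijnH t (rodgersTaoZ x κ)‖)
    (h9 : ∀ x : ℝ, C'' ≤ x → ∀ κ ∈ Icc C' C₈,
      ‖deriv (deBruijnH t) (rodgersTaoZ x κ) / deBruijnH t (rodgersTaoZ x κ) -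
          I / 4 * Complex.log (I * rodgersTaoZ x κ / (4 * π))‖ ≤ A * logPlus x / x)
    {R : ℝ} (hRdef : R = K ^ 2 / δ + K + 2 * C' + 2) (hC₇ : 4 * R ≤ C₇) (hC₈ : 4 * R ≤ C₈)
    {T : ℝ} (hT : 2 ≤ T) (hTC : 2 * C'' ≤ T) (hRT : 4 * R * Real.log (2 + T) ≤ T)
    (hTA : 4 * A + 2 ≤ Real.log (2 + T)) {s y : ℝ} (hs : |s| ≤ K) (hy : y ∈ Icc δ K) :
    ‖deriv (deBruijnH t) ((T : ℂ) + ((s : ℂ) - (y : ℂ) * I) * Real.log (2 + T)) /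
          deBruijnH t ((T : ℂ) + ((s : ℂ) - (y : ℂ) * I) * Real.log (2 + T)) /
          (Real.log (2 + T) : ℂ) - I / 4‖ ≤
      ((4 * A + 2) / Real.log (2 + T)) ^
          (1 - Real.log (Real.sqrt (K ^ 2 + (R - δ) ^ 2) / (R - 2 * C' - 2)) /
            Real.log ((R - δ / 2) / (R - 2 * C' - 2))) *
        (2 * ((π * R / 8 + 5 * A) + 2 * (π * R / 8 + 5 * A) * (R - δ / 2) /
            ((R - δ / 16) - (R - δ / 2))) / (δ / 4) + 1) := by
  -- constants
  set L : ℝ := Real.log (2 + T) with hL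
  obtain ⟨hL1, hLT⟩ := one_le_logPlus_le hT
  have hL0 : 0 < L := by linarith
  have hπ : 0 < π := Real.pi_pos
  have hK0 : 0 < K := by linarith
  have hKδ : 0 < K ^ 2 / δ := by positivity
  have hR0 : 0 < R := by rw [hRdef]; positivity
  set ρ₁ : ℝ := R - 2 * C' - 2 with hρ₁
  set ρ₂ : ℝ := Real.sqrt (K ^ 2 + (R - δ) ^ 2) with hρ₂
  set ρ₃ : ℝ := R - δ / 2 with hρ₃
  set C₁ : ℝ := π * R / 8 + 5 * A with hC₁
  set M₃ : ℝ := 2 * (C₁ + 2 * C₁ * ρ₃ / ((R - δ / 16) - ρ₃)) / (δ / 4) with hM₃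
  set η : ℝ := (4 * A + 2) / L with hη
  have hρ₁val : ρ₁ = K ^ 2 / δ + K := by rw [hρ₁, hRdef]; ring
  have hρ₁0 : 0 < ρ₁ := by rw [hρ₁val]; positivity
  have hRδ : 0 ≤ R - δ := by rw [hRdef]; linarith [hKδ.le]
  have hρ₂sq : ρ₂ ^ 2 = K ^ 2 + (R - δ) ^ 2 := Real.sq_sqrt (by positivity)
  have hρ₂0 : 0 ≤ ρ₂ := Real.sqrt_nonneg _
  have h12 : ρ₁ ≤ ρ₂ := by
    have h1 : ρ₁ ≤ R - δ := by rw [hρ₁]; linarith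
    calc ρ₁ ≤ R - δ := h1
      _ = Real.sqrt ((R - δ) ^ 2) := (Real.sqrt_sq hRδ).symm
      _ ≤ ρ₂ := Real.sqrt_le_sqrt (by nlinarith)
  have h23 : ρ₂ < ρ₃ := by
    have hρ₃0 : 0 < ρ₃ := by rw [hρ₃]; linarith
    have key : K ^ 2 + (R - δ) ^ 2 < ρ₃ ^ 2 := by
      have e : ρ₃ ^ 2 - (K ^ 2 + (R - δ) ^ 2) = δ * K + 2 * C' * δ + 2 * δ - 3 * δ ^ 2 / 4 := by
        rw [hρ₃, hRdef]; field_simp; ring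
      have h1 : 0 ≤ δ * K := mul_nonneg hδ.le hK0.le
      have h2 : 0 ≤ 2 * C' * δ := by positivity
      have h3 : 0 < 2 * δ - 3 * δ ^ 2 / 4 := by nlinarith
      linarith
    calc ρ₂ = Real.sqrt (K ^ 2 + (R - δ) ^ 2) := rfl
      _ < Real.sqrt (ρ₃ ^ 2) := Real.sqrt_lt_sqrt (by positivity) key
      _ = ρ₃ := Real.sqrt_sq hρ₃0.le
  have h3R' : ρ₃ < R - δ / 4 := by rw [hρ₃]; linarith
  have hC₁0 : 0 < C₁ := by rw [hC₁]; positivity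
  have hM₃0 : 0 ≤ M₃ := by
    rw [hM₃]
    have : 0 < (R - δ / 16) - ρ₃ := by rw [hρ₃]; linarith
    have hρ₃0 : 0 < ρ₃ := by rw [hρ₃]; linarith
    positivity
  have hη0 : 0 < η := by rw [hη]; positivity
  have hη1 : η ≤ 1 := by rw [hη, div_le_one hL0]; exact hTA
  -- the base point and the disc
  set c : ℂ := (T : ℂ) - ((R * L : ℝ) : ℂ) * I with hc
  have hcre : c.re = T := by simp [hc]
  have hcim : c.im = -(R * L) := by simp [hc]
  have hT0 : 0 ≤ T := by linarith
  -- points of the big disc: coordinates and `κ′`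
  have hgeom : ∀ w : ℂ, ‖w - c‖ ≤ (R - δ / 16) * L →
      T / 2 ≤ w.re ∧ w.re ≤ 2 * T ∧ -w.im ≤ w.re ∧ 0 ≤ -w.im / logPlus w.re ∧
        -w.im / logPlus w.re ≤ 4 * R ∧ δ / 16 * L ≤ -w.im ∧ |w.re - T| ≤ R * L ∧
        (2 * C' * L ≤ -w.im → C' ≤ -w.im / logPlus w.re) := by
    intro w hw
    obtain ⟨h1, h2⟩ := abs_re_im_sub_le w c
    rw [hcre] at h1
    rw [hcim] at h2
    have e : (R - δ / 16) * L = R * L - δ / 16 * L := by ring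
    have hδL : 0 ≤ δ / 16 * L := by positivity
    have hre : |w.re - T| ≤ R * L := by linarith
    obtain ⟨h2a, h2b⟩ := abs_le.1 h2
    have hv0 : δ / 16 * L ≤ -w.im := by linarith
    have hvhi : -w.im ≤ 2 * R * L := by linarith
    obtain ⟨g1, g2, g3, g4, g5, g6⟩ := kappa_bounds (C' := C') hT hR0 hRT hre (hδL.trans hv0) hvhi
    exact ⟨g1, g2, g3, g4, g5, hv0, hre, g6 hC'⟩
  -- `H_t ≠ 0` strictly below the real axis
  have hne : ∀ w : ℂ, w.im < 0 → deBruijnH t w ≠ 0 := fun w hw h0 ↦ by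
    have := hreal w h0; linarith
  have hball_im : ∀ w ∈ ball c ((R - δ / 16) * L), w.im < 0 := by
    intro w hw
    rw [mem_ball, dist_eq_norm] at hw
    obtain ⟨-, -, -, -, -, hv0, -⟩ := hgeom w hw.le
    have : 0 < δ / 16 * L := by positivity
    linarith
  have hF : DifferentiableOn ℂ (deBruijnH t) (ball c ((R - δ / 16) * L)) :=
    (differentiable_deBruijnH_holds t).differentiableOn
  have hF0 : ∀ w ∈ ball c ((R - δ / 16) * L), deBruijnH t w ≠ 0 :=
    fun w hw ↦ hne w (hball_im w hw)
  -- (ii) the Borel–Carathéodory constant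
  have hc8 : Real.exp (-(π * T / 8) - A * L ^ 2) ≤ ‖deBruijnH t c‖ := by
    have := h8 T (by linarith) R ⟨by rw [hRdef]; linarith [hKδ.le], by linarith⟩
    rwa [← base_eq_rodgersTaoZ hT0, logPlus_eq, abs_of_nonneg hT0] at this
  have hlog : ∀ w ∈ ball c ((R - δ / 16) * L),
      Real.log ‖deBruijnH t w‖ ≤ Real.log ‖deBruijnH t c‖ + C₁ * L ^ 2 := by
    intro w hw
    have hw' : ‖w - c‖ ≤ (R - δ / 16) * L := by rw [mem_ball, dist_eq_norm] at hw; exact hw.le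
    obtain ⟨g1, g2, g3, g4, g5, hv0, hre, -⟩ := hgeom w hw'
    have h7w := h7 w.re (by linarith) (-w.im / logPlus w.re) ⟨g4, by linarith⟩
    rw [← eq_rodgersTaoZ w] at h7w
    exact log_norm_le_of_eq7_eq8 hT hA (hF0 w hw) g1 g2 hre h7w hc8
  -- (iii) the a-priori bound on `‖w − c‖ ≤ ρ₃ L`
  have hapriori : ∀ w : ℂ, ‖w - c‖ ≤ ρ₃ * L →
      ‖deriv (deBruijnH t) w / deBruijnH t w‖ ≤ M₃ * L := by
    intro w hw
    have hM : 0 < C₁ * L ^ 2 := by positivity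
    have hρ : 0 < δ / 4 * L := by positivity
    have hrρ : ρ₃ * L + δ / 4 * L ≤ (R - δ / 16) * L := by
      have e1 : ρ₃ * L + δ / 4 * L = (R - δ / 16) * L - 3 * δ / 16 * L := by rw [hρ₃]; ring
      have : 0 ≤ 3 * δ / 16 * L := by positivity
      linarith
    have key := norm_logDeriv_le_of_log_norm_le_offCentre hM hρ hw hrρ hF hF0 hlog
    have e : 2 * (C₁ * L ^ 2 + 2 * (C₁ * L ^ 2) * (ρ₃ * L) / ((R - δ / 16) * L - ρ₃ * L)) /
        (δ / 4 * L) = M₃ * L := by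
      rw [hM₃]
      have h1 : (R - δ / 16) * L - ρ₃ * L = ((R - δ / 16) - ρ₃) * L := by ring
      have h2 : (R - δ / 16) - ρ₃ ≠ 0 := by rw [hρ₃]; intro h; linarith
      rw [h1]
      field_simp
    rw [e] at key
    exact key
  -- the function `G = H′/H/L − i/4` and its holomorphy on the disc of radius `(R − δ/4)L`
  set G : ℂ → ℂ := fun w ↦ deriv (deBruijnH t) w / deBruijnH t w / (L : ℂ) - I / 4 with hG
  have hsub : ball c ((R - δ / 4) * L) ⊆ ball c ((R - δ / 16) * L) :=
    ball_subset_ball (mul_le_mul_of_nonneg_right (by linarith) hL0.le)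
  have hGd : DifferentiableOn ℂ G (ball c ((R - δ / 4) * L)) := by
    have hd : DifferentiableOn ℂ (deBruijnH t) (ball c ((R - δ / 4) * L)) := hF.mono hsub
    have hd' : DifferentiableOn ℂ (deriv (deBruijnH t)) (ball c ((R - δ / 4) * L)) :=
      hd.deriv isOpen_ball
    exact ((hd'.div hd fun w hw ↦ hF0 w (hsub hw)).div_const _).sub_const _
  -- (iv) smallness on the deep disc `‖w − c‖ ≤ ρ₁ L`
  have hdeep : ∀ w : ℂ, ‖w - c‖ ≤ ρ₁ * L → ‖G w‖ ≤ η := by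
    intro w hw
    have hw' : ‖w - c‖ ≤ (R - δ / 16) * L := by
      have : ρ₁ * L ≤ (R - δ / 16) * L :=
        mul_le_mul_of_nonneg_right (by rw [hρ₁]; linarith) hL0.le
      linarith
    obtain ⟨g1, g2, g3, g4, g5, hv0, hre, g6⟩ := hgeom w hw'
    obtain ⟨-, h2⟩ := abs_re_im_sub_le w c
    rw [hcim] at h2
    have hvdeep : 2 * C' * L ≤ -w.im := by
      obtain ⟨-, h2b⟩ := abs_le.1 h2
      have e : ρ₁ * L = R * L - 2 * C' * L - 2 * L := by rw [hρ₁]; ring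
      linarith
    have hκ : -w.im / logPlus w.re ∈ Icc C' C₈ := ⟨g6 hvdeep, by linarith⟩
    have h9w := h9 w.re (by linarith) _ hκ
    rw [← eq_rodgersTaoZ w] at h9w
    -- rewrite `w` as `u − v i`
    have hwuv : w = (w.re : ℂ) - ((-w.im : ℝ) : ℂ) * I := by
      apply Complex.ext <;> simp
    have h9' : ‖deriv (deBruijnH t) w / deBruijnH t w -
        I / 4 * Complex.log (I * ((w.re : ℂ) - ((-w.im : ℝ) : ℂ) * I) / (4 * π))‖ ≤
        A * logPlus w.re / w.re := by rw [← hwuv]; exact h9w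
    have hB4 := norm_div_logPlus_sub_le_of_eq9 hT g1 g2
      ((by positivity : (0 : ℝ) ≤ δ / 16 * L).trans hv0) g3 h9'
    have hE := eq9_error_le hT hA g1 g2
    calc ‖G w‖ = ‖deriv (deBruijnH t) w / deBruijnH t w / (Real.log (2 + T) : ℂ) - I / 4‖ := rfl
      _ ≤ (A * logPlus w.re / w.re + 2) / Real.log (2 + T) := hB4
      _ ≤ η := by rw [hη]; exact div_le_div_of_nonneg_right (by linarith) hL0.le
  -- (iii') bound on the outer circle
  have houter : ∀ w : ℂ, ‖w - c‖ = ρ₃ * L → ‖G w‖ ≤ M₃ + 1 := by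
    intro w hw
    have h1 := hapriori w hw.le
    have hLc : ‖(L : ℂ)‖ = L := by rw [Complex.norm_real, Real.norm_of_nonneg hL0.le]
    have hq : ‖deriv (deBruijnH t) w / deBruijnH t w / (L : ℂ)‖ ≤ M₃ := by
      rw [norm_div, hLc, div_le_iff₀ hL0]; exact h1
    have hI : ‖(I / 4 : ℂ)‖ ≤ 1 := by
      rw [norm_div, Complex.norm_I]
      have : ‖(4 : ℂ)‖ = 4 := by simp
      rw [this]; norm_num
    calc ‖G w‖ ≤ ‖deriv (deBruijnH t) w / deBruijnH t w / (L : ℂ)‖ + ‖(I / 4 : ℂ)‖ :=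
        norm_sub_le _ _
      _ ≤ M₃ + 1 := by linarith
  -- (v) three circles at the target point
  have hM1 : 1 ≤ M₃ + 1 := by linarith
  have h3R : ρ₃ * L < (R - δ / 4) * L := mul_lt_mul_of_pos_right h3R' hL0
  set w₀ : ℂ := (T : ℂ) + ((s : ℂ) - (y : ℂ) * I) * (L : ℂ) with hw₀
  have hw₀c : ‖w₀ - c‖ ≤ ρ₂ * L := by
    have e : w₀ - c = ((s : ℂ) + ((R - y : ℝ) : ℂ) * I) * (L : ℂ) := by
      rw [hw₀, hc]; push_cast; ring
    rw [e, norm_mul, Complex.norm_real, Real.norm_of_nonneg hL0.le]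
    refine mul_le_mul_of_nonneg_right ?_ hL0.le
    have hn : ‖(s : ℂ) + ((R - y : ℝ) : ℂ) * I‖ = Real.sqrt (s ^ 2 + (R - y) ^ 2) := by
      rw [Complex.norm_eq_sqrt_sq_add_sq]; simp
    rw [hn, hρ₂]
    refine Real.sqrt_le_sqrt ?_
    have hs2 : s ^ 2 ≤ K ^ 2 := by rw [← sq_abs]; exact pow_le_pow_left₀ (abs_nonneg s) hs 2
    have hy2 : (R - y) ^ 2 ≤ (R - δ) ^ 2 := by
      have hKR : K ≤ R := by rw [hRdef]; linarith [hKδ.le]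
      have h1 : 0 ≤ R - y := by linarith [hy.2]
      exact pow_le_pow_left₀ h1 (by linarith [hy.1]) 2
    linarith
  have key := norm_le_of_three_circles_decay (c := c) (G := G) (by positivity : 0 < ρ₁ * L)
    (mul_le_mul_of_nonneg_right h12 hL0.le) (mul_lt_mul_of_pos_right h23 hL0) h3R hGd hη0 hη1
    hM1 hdeep houter hw₀c
  have hratio1 : ρ₂ * L / (ρ₁ * L) = ρ₂ / ρ₁ := mul_div_mul_right _ _ hL0.ne'
  have hratio2 : ρ₃ * L / (ρ₁ * L) = ρ₃ / ρ₁ := mul_div_mul_right _ _ hL0.ne'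
  rw [hratio1, hratio2] at key
  exact key


/-! ## Stage B over the kernel theorems: the propagated asymptotic on a time window -/

/-- `4R·log(2+T) ≤ T` once `T ≥ (8R+2)²` (`R > 0`). [folklore] -/
private theorem four_mul_log_le {R T : ℝ} (hR : 0 < R) (hT : (8 * R + 2) ^ 2 ≤ T) :
    4 * R * Real.log (2 + T) ≤ T := by
  have hT0 : 0 < 2 + T := by nlinarith
  set u : ℝ := Real.sqrt (2 + T) with hu
  have hu0 : 0 < u := Real.sqrt_pos.2 hT0
  have huu : u * u = 2 + T := Real.mul_self_sqrt hT0.le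
  have hu1 : 8 * R + 2 ≤ u := by
    rw [hu, ← Real.sqrt_sq (by positivity : (0 : ℝ) ≤ 8 * R + 2)]
    exact Real.sqrt_le_sqrt (by nlinarith)
  have hlog : Real.log (2 + T) ≤ 2 * (u - 1) := by
    have h1 : Real.log (2 + T) = 2 * Real.log u := by
      rw [hu, Real.log_sqrt hT0.le]; ring
    rw [h1]
    linarith [Real.log_le_sub_one_of_pos hu0]
  nlinarith

/-- `4A + 2 ≤ log(2+T)` once `T ≥ exp(4A+2)`. [folklore] -/
private theorem const_le_log {A T : ℝ} (hT : Real.exp (4 * A + 2) ≤ T) :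
    4 * A + 2 ≤ Real.log (2 + T) := by
  have h0 : 0 < Real.exp (4 * A + 2) := Real.exp_pos _
  calc 4 * A + 2 = Real.log (Real.exp (4 * A + 2)) := (Real.log_exp _).symm
    _ ≤ Real.log (2 + T) := Real.log_le_log h0 (by linarith)


/-- **Stage B of the effective Theorem 9 (49), over the kernel theorems.** For every `T₀` and
`0 < δ ≤ 1 ≤ K` there are `T₁`, `Cst ≥ 0` and `θ > 0` such that for every `t ∈ [−T₀, 0]` with `H_t`
real-rooted, every `T ≥ T₁`, `|s| ≤ K` and `y ∈ [δ, K]`: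
`‖(H_t′/H_t)(T + (s − iy) log(2+T))/log(2+T) − i/4‖ ≤ Cst · log(2+T)^{−θ}` — Lemma 2.1 (7), (8),
(9) in the tree's discharged forms `rodgersTao_H_bound_holds`, `rodgersTao_H_asymp_holds`,
`rodgersTao_logDeriv_H_asymp_holds` (constants uniform in `t ∈ [−T₀, 0]`) fed into
`norm_logDeriv_rescaled_sub_le`. This is «F_n′ → 1/4 locally uniformly on the lower half-plane»
of the proof of Theorem 9 (49), p. 25, with an explicit rate and uniformly in `t`.
[cite: RodgersTaoFMP2020, Lemma 4 (7)(8)(9) p.8 and Theorem 9 (49) proof p.25] -/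
theorem exists_norm_logDeriv_rescaled_sub_le (T₀ : ℝ) {δ K : ℝ} (hδ : 0 < δ) (hδ1 : δ ≤ 1)
    (hK : 1 ≤ K) :
    ∃ T₁ Cst θ : ℝ, 0 < θ ∧ 0 ≤ Cst ∧ ∀ t ∈ Icc (-T₀) 0, HasOnlyRealZeros (deBruijnH t) →
      ∀ T : ℝ, T₁ ≤ T → ∀ s : ℝ, |s| ≤ K → ∀ y ∈ Icc δ K,
        ‖deriv (deBruijnH t) ((T : ℂ) + ((s : ℂ) - (y : ℂ) * I) * Real.log (2 + T)) /
              deBruijnH t ((T : ℂ) + ((s : ℂ) - (y : ℂ) * I) * Real.log (2 + T)) /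
              (Real.log (2 + T) : ℂ) - I / 4‖ ≤
          Cst * Real.log (2 + T) ^ (-θ) := by
  -- the constants of (8) and (9) on the window, with a common `C′`
  obtain ⟨C'₈, hC'₈, h8C⟩ := rodgersTao_H_asymp_holds T₀
  obtain ⟨C'₉, hC'₉, h9C⟩ := rodgersTao_logDeriv_H_asymp_holds T₀
  set C' : ℝ := max C'₈ C'₉ with hC'
  have hC'0 : 0 ≤ C' := le_max_of_le_left hC'₈.le
  set R : ℝ := K ^ 2 / δ + K + 2 * C' + 2 with hRdef
  have hK0 : 0 < K := by linarith
  have hR0 : 0 < R := by rw [hRdef]; positivity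
  obtain ⟨C''₈, A₈, hC''₈, hA₈, h8⟩ := h8C (4 * R)
  obtain ⟨C''₉, A₉, hC''₉, hA₉, h9⟩ := h9C (4 * R)
  obtain ⟨A₇, hA₇, h7⟩ := rodgersTao_H_bound_holds (4 * R) T₀
  set A : ℝ := max A₇ (max A₈ A₉) with hA
  have hA0 : 0 ≤ A := le_max_of_le_left hA₇.le
  have hA7 : A₇ ≤ A := le_max_left _ _
  have hA8 : A₈ ≤ A := (le_max_left _ _).trans (le_max_right _ _)
  have hA9 : A₉ ≤ A := (le_max_right _ _).trans (le_max_right _ _)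
  set C'' : ℝ := max C''₈ C''₉ with hC''
  -- radii and the exponent
  set ρ₁ : ℝ := R - 2 * C' - 2 with hρ₁
  set ρ₂ : ℝ := Real.sqrt (K ^ 2 + (R - δ) ^ 2) with hρ₂
  set ρ₃ : ℝ := R - δ / 2 with hρ₃
  set a₂ : ℝ := Real.log (ρ₂ / ρ₁) / Real.log (ρ₃ / ρ₁) with ha₂
  set M₃ : ℝ := 2 * ((π * R / 8 + 5 * A) + 2 * (π * R / 8 + 5 * A) * (R - δ / 2) /
      ((R - δ / 16) - (R - δ / 2))) / (δ / 4) with hM₃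
  have hρ₁0 : 0 < ρ₁ := by
    have : ρ₁ = K ^ 2 / δ + K := by rw [hρ₁, hRdef]; ring
    rw [this]; positivity
  have hKδ : 0 < K ^ 2 / δ := by positivity
  have hRδ : 0 ≤ R - δ := by rw [hRdef]; linarith [hKδ.le]
  have h12 : ρ₁ ≤ ρ₂ := by
    have h1 : ρ₁ ≤ R - δ := by rw [hρ₁]; linarith
    calc ρ₁ ≤ R - δ := h1
      _ = Real.sqrt ((R - δ) ^ 2) := (Real.sqrt_sq hRδ).symm
      _ ≤ ρ₂ := Real.sqrt_le_sqrt (by nlinarith)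
  have h23 : ρ₂ < ρ₃ := by
    have hρ₃0 : 0 < ρ₃ := by rw [hρ₃]; linarith
    have key : K ^ 2 + (R - δ) ^ 2 < ρ₃ ^ 2 := by
      have e : ρ₃ ^ 2 - (K ^ 2 + (R - δ) ^ 2) = δ * K + 2 * C' * δ + 2 * δ - 3 * δ ^ 2 / 4 := by
        rw [hρ₃, hRdef]; field_simp; ring
      have h1 : 0 ≤ δ * K := mul_nonneg hδ.le hK0.le
      have h2 : 0 ≤ 2 * C' * δ := by positivity
      have h3 : 0 < 2 * δ - 3 * δ ^ 2 / 4 := by nlinarith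
      linarith
    calc ρ₂ = Real.sqrt (K ^ 2 + (R - δ) ^ 2) := rfl
      _ < Real.sqrt (ρ₃ ^ 2) := Real.sqrt_lt_sqrt (by positivity) key
      _ = ρ₃ := Real.sqrt_sq hρ₃0.le
  have hlog31 : 0 < Real.log (ρ₃ / ρ₁) :=
    Real.log_pos (by rw [one_lt_div hρ₁0]; linarith)
  have ha₂1 : a₂ < 1 := by
    rw [ha₂, div_lt_one hlog31]
    exact Real.log_lt_log (div_pos (by linarith) hρ₁0) (div_lt_div_of_pos_right h23 hρ₁0)
  have hM₃0 : 0 ≤ M₃ := by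
    rw [hM₃]
    have : 0 < (R - δ / 16) - (R - δ / 2) := by linarith
    have : 0 < R - δ / 2 := by linarith
    have : 0 < π * R / 8 + 5 * A := by positivity
    positivity
  -- the threshold
  set T₁ : ℝ := max (max 2 (2 * C'')) (max (Real.exp (4 * A + 2)) ((8 * R + 2) ^ 2)) with hT₁
  refine ⟨T₁, (4 * A + 2) ^ (1 - a₂) * (M₃ + 1), 1 - a₂, by linarith, by positivity, ?_⟩
  intro t ht hreal T hT s hs y hy
  have hT2 : 2 ≤ T := le_trans (le_max_left _ _ |>.trans' (le_max_left _ _)) hT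
  have hTC : 2 * C'' ≤ T := le_trans (le_max_left _ _ |>.trans' (le_max_right _ _)) hT
  have hTA : Real.exp (4 * A + 2) ≤ T := le_trans (le_max_right _ _ |>.trans' (le_max_left _ _)) hT
  have hTR : (8 * R + 2) ^ 2 ≤ T := le_trans (le_max_right _ _ |>.trans' (le_max_right _ _)) hT
  have hRT := four_mul_log_le hR0 hTR
  have hTA' := const_le_log hTA
  -- the hypotheses of the schema at time `t`
  have h7t : ∀ x : ℝ, 0 ≤ x → ∀ κ ∈ Icc 0 (4 * R),
      ‖deBruijnH t (rodgersTaoZ x κ)‖ ≤ Real.exp (-(π * x / 8) + A * logPlus x ^ 2) := by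
    intro x hx κ hκ
    refine (h7 t ht x hx κ hκ).trans (Real.exp_monotone ?_)
    have h1 : A₇ * logPlus x ^ 2 ≤ A * logPlus x ^ 2 :=
      mul_le_mul_of_nonneg_right hA7 (sq_nonneg _)
    linarith
  have h8t : ∀ x : ℝ, C'' ≤ x → ∀ κ ∈ Icc C' (4 * R),
      Real.exp (-(π * x / 8) - A * logPlus x ^ 2) ≤ ‖deBruijnH t (rodgersTaoZ x κ)‖ := by
    intro x hx κ hκ
    have hκ' : κ ∈ Icc C'₈ (4 * R) := ⟨(le_max_left _ _).trans hκ.1, hκ.2⟩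
    refine le_trans (Real.exp_monotone ?_) (h8 t ht x ((le_max_left _ _).trans hx) κ hκ').1
    have h1 : A₈ * logPlus x ^ 2 ≤ A * logPlus x ^ 2 :=
      mul_le_mul_of_nonneg_right hA8 (sq_nonneg _)
    linarith
  have h9t : ∀ x : ℝ, C'' ≤ x → ∀ κ ∈ Icc C' (4 * R),
      ‖deriv (deBruijnH t) (rodgersTaoZ x κ) / deBruijnH t (rodgersTaoZ x κ) -
          I / 4 * Complex.log (I * rodgersTaoZ x κ / (4 * π))‖ ≤ A * logPlus x / x := by
    intro x hx κ hκ
    have hκ' : κ ∈ Icc C'₉ (4 * R) := ⟨(le_max_right _ _).trans hκ.1, hκ.2⟩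
    have hx0 : 0 < x := lt_of_lt_of_le (lt_of_lt_of_le hC''₉ (le_max_right _ _)) hx
    refine (h9 t ht x ((le_max_right _ _).trans hx) κ hκ').trans ?_
    exact div_le_div_of_nonneg_right (mul_le_mul_of_nonneg_right hA9 (logPlus_nonneg _)) hx0.le
  have key := norm_logDeriv_rescaled_sub_le hreal hC'0 hA0 hδ hδ1 hK h7t h8t h9t hRdef le_rfl
    le_rfl hT2 hTC hRT hTA' hs hy
  -- `((4A+2)/L)^{1−a₂} (M₃+1) = (4A+2)^{1−a₂} (M₃+1) L^{−(1−a₂)}`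
  have hL0 : 0 < Real.log (2 + T) := Real.log_pos (by linarith)
  have e : ((4 * A + 2) / Real.log (2 + T)) ^ (1 - a₂) * (M₃ + 1) =
      (4 * A + 2) ^ (1 - a₂) * (M₃ + 1) * Real.log (2 + T) ^ (-(1 - a₂)) := by
    rw [Real.div_rpow (by positivity) hL0.le, Real.rpow_neg hL0.le]
    ring
  rw [e] at key
  exact key


/-! ## Glue: from the rescaled norm bound to two-sided bounds for `Im H_t′/H_t` -/

/-- If `‖D/L − i/4‖ ≤ E` (`L > 0`) then `(1/4 − E)·L ≤ Im D ≤ (1/4 + E)·L`: the form in which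
stage B feeds the Poisson counting of stage C (`Im (H_t′/H_t)(u − iY)` at `Y = y·log(2+T)` is
`(1/4 + o(1)) log(2+T)`). [cite: RodgersTaoFMP2020, Theorem 9 (49) proof p.25 (eq. (htn): H′/H = (1+o(1)) log₊T/4 on Γ_II)] -/
theorem im_bounds_of_norm_div_sub_le {D : ℂ} {L E : ℝ} (hL : 0 < L)
    (h : ‖D / (L : ℂ) - I / 4‖ ≤ E) :
    (1 / 4 - E) * L ≤ D.im ∧ D.im ≤ (1 / 4 + E) * L := by
  have him : |(D / (L : ℂ) - I / 4).im| ≤ E := (Complex.abs_im_le_norm _).trans h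
  have e : (D / (L : ℂ) - I / 4).im = D.im / L - 1 / 4 := by
    have h4 : (I / 4 : ℂ).im = 1 / 4 := by simp
    rw [Complex.sub_im, Complex.div_ofReal_im, h4]
  rw [e] at him
  obtain ⟨h1, h2⟩ := abs_le.1 him
  constructor
  · have : (1 / 4 - E) ≤ D.im / L := by linarith
    rwa [le_div_iff₀ hL] at this
  · have : D.im / L ≤ 1 / 4 + E := by linarith
    rwa [div_le_iff₀ hL] at this

/-- **Two-sided control of `Im H_t′/H_t` at heights `y·log(2+T)`, `δ ≤ y ≤ K`, uniformly on a time
window** (stage B in the form consumed by the Poisson counting): with the `T₁, Cst, θ` of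
`exists_norm_logDeriv_rescaled_sub_le`,
`(1/4 − Cst L^{−θ}) L ≤ Im (H_t′/H_t)(T + sL − i yL) ≤ (1/4 + Cst L^{−θ}) L`, `L = log(2+T)`.
[cite: RodgersTaoFMP2020, Theorem 9 (49) proof p.25 (eq. (htn))] -/
theorem exists_im_logDeriv_bounds (T₀ : ℝ) {δ K : ℝ} (hδ : 0 < δ) (hδ1 : δ ≤ 1) (hK : 1 ≤ K) :
    ∃ T₁ Cst θ : ℝ, 0 < θ ∧ 0 ≤ Cst ∧ ∀ t ∈ Icc (-T₀) 0, HasOnlyRealZeros (deBruijnH t) →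
      ∀ T : ℝ, T₁ ≤ T → ∀ s : ℝ, |s| ≤ K → ∀ y ∈ Icc δ K,
        (1 / 4 - Cst * Real.log (2 + T) ^ (-θ)) * Real.log (2 + T) ≤
            (deriv (deBruijnH t) ((T : ℂ) + ((s : ℂ) - (y : ℂ) * I) * Real.log (2 + T)) /
              deBruijnH t ((T : ℂ) + ((s : ℂ) - (y : ℂ) * I) * Real.log (2 + T))).im ∧
          (deriv (deBruijnH t) ((T : ℂ) + ((s : ℂ) - (y : ℂ) * I) * Real.log (2 + T)) /
              deBruijnH t ((T : ℂ) + ((s : ℂ) - (y : ℂ) * I) * Real.log (2 + T))).im ≤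
            (1 / 4 + Cst * Real.log (2 + T) ^ (-θ)) * Real.log (2 + T) := by
  obtain ⟨T₁, Cst, θ, hθ, hCst, h⟩ := exists_norm_logDeriv_rescaled_sub_le T₀ hδ hδ1 hK
  refine ⟨max T₁ 0, Cst, θ, hθ, hCst, fun t ht hreal T hT s hs y hy ↦ ?_⟩
  have hT' : T₁ ≤ T := (le_max_left _ _).trans hT
  have hT0 : 0 ≤ T := (le_max_right _ _).trans hT
  have hL : 0 < Real.log (2 + T) := Real.log_pos (by linarith)
  exact im_bounds_of_norm_div_sub_le hL (h t ht hreal T hT' s hs y hy)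

end RodgersTaoLogDerivPropagation

end Literature.NumberTheory.LFunctions
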